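import Summits.BirchSwinnertonDyer.BirchSwinnertonDyer.Theorems.GoldfeldAllTwistsTwoConverseTwinGenusRankOneRat
import Summits.BirchSwinnertonDyer.BirchSwinnertonDyer.Theorems.GoldfeldAllTwistsTwoConverseTwinTorsion
import Literature.NumberTheory.EllipticCurves.BSDInvariantsProofs
import Literature.NumberTheory.EllipticCurves.Curve49A1Points
import HarnessLib

set_option linter.dupNamespace false -- `…BirchSwinnertonDyer.BirchSwinnertonDyer…` is the cell's namespace (D-0017)
set_option autoImplicit false

/-!
# LINE B49 — THEOREM B, local input (B1c-α): `#X₀(49)(K)_tors = 2` for every imaginary quadratic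
# `K = ℚ(√−q)` with `d_K = −4q`, `q` prime, `(q/7) = −1`

Cell `bsd-goldfeld`, seat `bsd-goldfeld-s1p-c301` (prover, gen 8); planner ruling g19 (liii) (THEOREM B = clause
(ii) of `X049BirchLemmaEvenDiscr`), scope memo `HOME/GENUS-THEOREM-B.md` factor F4 (`t_K = #cm7(K)_tors`).
Support for item `stmt-BirchSwinnertonDyer-19140` (twin″); Theses-free; theorems only. HONEST FRAMING: a
torsion computation over an infinite family of quadratic fields; nothing about `L`-values or BSD.

WHAT IS PROVED (uniformly in `q`). Let `q` be a prime with `(q/7) = −1` and `K` imaginary quadratic with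
`d_K = −4q`. On the two-torsion model `M₀ = ⟨0, 21, 0, 112, 0⟩ = cm7NFChange • X₀(49)` (seat c3's
`cm7NFChange_smul`, over any field of characteristic `0`):
* §1 `−7, 7, 2, 14` are not squares in `K` (`not_isSquare_inertField`: a rational that is a square in `K` is
  a rational square or `d_K = −4q` times one, `isSquare_or_of_isSquare_algebraMap_rat` + seat c3's
  `not_isSquare_genusConstants`);
* §2 `M₀` and its quadratic twists have `#(ℚ-torsion) = 2` (`j = −3375`, `torsionOrder_eq_two_of_j_eq`), so a
  `ℚ`-point killed by an ODD integer is `O`;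
* §3 a point of `M₀(K)` killed by an odd integer is `O`: with `σ` the conjugation of `K/ℚ`, `P + σP` comes
  from `M₀(ℚ)` (`exists_incl_eq_of_conjMap_eq`) and is killed by the same odd integer, hence is `O`; so
  `σP = −P` and `P` comes from the twist `M₀^{(d_K)}(ℚ)` (`exists_twistMap_eq_of_conjMap_eq_neg`), again `O`;
* §4 hence `M₀(K)_tors = {O, T}` (the `2`-primary part is `{O, T}` by `−7, 7 ∉ K²`: the tree's
  `exists_odd_nsmul_mem_pair` / `eq_zero_or_eq_twoTorsionPoint_of_two_nsmul_eq_zero`), `#M₀(K)_tors = 2`, and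
  **`torsionOrder_cm7_baseChange_eq_two : (cm7.baseChange K).torsionOrder = 2`** (transport along
  `cm7NFChange K`, `torsionOrder_variableChange_holds`).
References: [SilvermanAEC2009] VII.3, VIII.7, X.2 Prop. 2.4 and Exercise 10.16; [SilvermanTate2015] §3.5;
[BurungaleCastellaSkinnerTian2022] Rem. D (p. 327) (`E(ℚ)[2] = ℤ/2` for every `ℚ(√−7)`-CM curve).
-/

noncomputable section

open scoped Classical

open WeierstrassCurve Literature.NumberTheory.EllipticCurves Literature.NumberTheory.EllipticCurves.ModularForms
  WeierstrassCurve.QuadraticDescent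

namespace Summit.BirchSwinnertonDyer.BirchSwinnertonDyer.Theorems.GoldfeldGoodTwists

-- One decidability world for all point groups (`ℚ`, `K`): the classical one, as in the generic tree files
-- (`QuadraticDescent.incl` / `twistMap`, `torsionOrder`) and in seat c3's `…TwinGenusRankOneRat`; without it the
-- `ℚ`-points of the literal models elaborate with `instDecidableEqRat` and do not match the generic homomorphisms.
attribute [local instance 2000] Classical.propDecidable

/-! ## §1 The four non-squares of `K = ℚ(√−q)` -/

section Squares

variable {K : Type} [Field K] [NumberField K]

/-- **`−7, 7, 2, 14` are not squares in `K`** for `K` imaginary quadratic with `d_K = −4q`, `q` prime,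
`(q/7) = −1` (so `q ≠ 2, 7`): a rational square in `K` is a square in `ℚ` or `−4q` times one.
[cite: SilvermanTate2015, §3.5] -/
theorem not_isSquare_inertField (hK : IsImaginaryQuadratic K) {q : ℕ} (hq : q.Prime)
    (hq7 : jacobiSym q 7 = -1) (hdK : NumberField.discr K = -(4 * (q : ℤ))) :
    ¬ IsSquare (-7 : K) ∧ ¬ IsSquare (7 : K) ∧ ¬ IsSquare (2 : K) ∧ ¬ IsSquare (14 : K) := by
  obtain ⟨hq2, hq7'⟩ := ne_two_and_ne_seven_of_jacobiSym hq7
  obtain ⟨⟨a1, a2⟩, ⟨b1, b2⟩, -, ⟨d1, d2⟩, -, ⟨f1, f2⟩⟩ := not_isSquare_genusConstants hq hq2 hq7'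
  have hdQ : ((NumberField.discr K : ℤ) : ℚ) = -(4 * (q : ℚ)) := by rw [hdK]; push_cast; ring
  have red : ∀ c : ℚ, IsSquare ((c : K)) → IsSquare c ∨ IsSquare (c * -(4 * (q : ℚ))) := by
    intro c hc
    rw [← hdQ]
    refine isSquare_or_of_isSquare_algebraMap_rat hK ?_
    rwa [eq_ratCast]
  refine ⟨fun h => ?_, fun h => ?_, fun h => ?_, fun h => ?_⟩
  · rcases red (-7) (by push_cast; exact h) with h' | h'
    · exact a1 h'
    · exact a2 h'
  · rcases red 7 (by push_cast; exact h) with h' | h'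
    · exact b1 h'
    · exact b2 h'
  · rcases red 2 (by push_cast; exact h) with h' | h'
    · exact d1 h'
    · exact d2 h'
  · rcases red 14 (by push_cast; exact h) with h' | h'
    · exact f1 h'
    · exact f2 h'

end Squares

/-! ## §2 The two-torsion model `M₀ = ⟨0, 21, 0, 112, 0⟩` of `X₀(49)` over `ℚ` and its twists -/

section M0

/-- `cm7NFChange • X₀(49) = M₀` over `ℚ` (seat c3's `cm7NFChange_smul` at `F = ℚ`). [cite: SilvermanAEC2009, III.1 Table 3.1] -/
theorem cm7NFChange_smul_rat : cm7NFChange ℚ • cm7 = (⟨0, 21, 0, 112, 0⟩ : WeierstrassCurve ℚ) := by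
  ext <;> simp [cm7NFChange, variableChange_a₁, variableChange_a₂, variableChange_a₃,
    variableChange_a₄, variableChange_a₆] <;> norm_num

/-- `j(M₀) = −3375` (for any elliptic structure on the literal model). [cite: CoatesLiTianZhai2015, §1 (p. 359, the curve A)] -/
theorem j_M0 [h : (⟨0, 21, 0, 112, 0⟩ : WeierstrassCurve ℚ).IsElliptic] :
    (⟨0, 21, 0, 112, 0⟩ : WeierstrassCurve ℚ).j = -3375 := by
  rw [j_eq_c₄_pow_div]
  norm_num [WeierstrassCurve.c₄, WeierstrassCurve.b₂, WeierstrassCurve.b₄, WeierstrassCurve.Δ,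
    WeierstrassCurve.b₆, WeierstrassCurve.b₈]

/-- The completed-square copy of `M₀` is `M₀` (`a₁ = a₃ = 0` already). [cite: SilvermanAEC2009, III.1] -/
theorem M0_quadraticTwist_one :
    (⟨0, 21, 0, 112, 0⟩ : WeierstrassCurve ℚ).quadraticTwist 1 = ⟨0, 21, 0, 112, 0⟩ := by
  ext <;> simp [quadraticTwist, b₂, b₄, b₆]

/-- A `ℚ`-point of a curve with `#E(ℚ)_tors = 2` killed by an ODD integer is `O`. [cite: SilvermanAEC2009, VII.3 and VIII.7] -/
theorem eq_zero_of_odd_nsmul_eq_zero_of_torsionOrder_eq_two {V : WeierstrassCurve ℚ}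
    (hV : V.torsionOrder = 2) {Q : V.toAffine.Point} {n : ℕ} (hn : Odd n) (hQ : n • Q = 0) : Q = 0 := by
  have hfin : IsOfFinAddOrder Q := isOfFinAddOrder_iff_nsmul_eq_zero.mpr ⟨n, hn.pos, hQ⟩
  have hmem : Q ∈ AddCommGroup.torsion V.toAffine.Point := (AddCommGroup.mem_torsion _).mpr hfin
  have hcard : Nat.card (AddCommGroup.torsion V.toAffine.Point) = 2 := by
    have h := hV
    unfold WeierstrassCurve.torsionOrder at h
    convert h using 2
  have h2 : addOrderOf Q ∣ 2 := by
    have h := addOrderOf_dvd_natCard (⟨Q, hmem⟩ : AddCommGroup.torsion V.toAffine.Point)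
    rw [hcard, AddSubgroup.addOrderOf_mk] at h
    exact h
  have hn' : addOrderOf Q ∣ n := addOrderOf_dvd_of_nsmul_eq_zero hQ
  rcases (Nat.dvd_prime Nat.prime_two).mp h2 with h1 | h1
  · exact AddMonoid.addOrderOf_eq_one_iff.mp h1
  · exfalso
    rw [h1] at hn'
    exact (Nat.not_even_iff_odd.mpr hn) (even_iff_two_dvd.mpr hn')

/-- `#M₀^{(1)}(ℚ)_tors = 2` (`j = −3375`). [cite: BurungaleCastellaSkinnerTian2022, Rem. D (p. 327)] -/
theorem torsionOrder_M0_quadraticTwist_one :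
    ((⟨0, 21, 0, 112, 0⟩ : WeierstrassCurve ℚ).quadraticTwist 1).torsionOrder = 2 := by
  rw [M0_quadraticTwist_one]
  haveI := Curve49A1.isElliptic
  exact torsionOrder_eq_two_of_j_eq _ (Or.inl j_M0)

/-- `#M₀^{(d)}(ℚ)_tors = 2` for `d ≠ 0` (`j(M₀^{(d)}) = j(M₀) = −3375`).
[cite: BurungaleCastellaSkinnerTian2022, Rem. D (p. 327)] -/
theorem torsionOrder_M0_quadraticTwist {d : ℚ} (hd : d ≠ 0) :
    ((⟨0, 21, 0, 112, 0⟩ : WeierstrassCurve ℚ).quadraticTwist d).torsionOrder = 2 := by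
  haveI := Curve49A1.isElliptic
  haveI := (⟨0, 21, 0, 112, 0⟩ : WeierstrassCurve ℚ).isElliptic_quadraticTwist hd
  exact torsionOrder_eq_two_of_j_eq _ (Or.inl (by rw [j_quadraticTwist _ hd, j_M0]))

end M0

/-! ## §3 Over `K`: a point of `M₀(K)` killed by an odd integer is `O` -/

section OverK

variable {K : Type} [Field K] [NumberField K]

/-- **Odd torsion of `M₀(K)` is trivial** (on the completed-square copy `M₀^{(1)} ⊗ K`, the model of the
tree's `QuadraticDescent`): for `K` imaginary quadratic with `d_K = −4q` and `P ∈ M₀^{(1)}(K)` with `n • P = O`,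
`n` odd: `P + σP ∈ M₀^{(1)}(ℚ)` is killed by `n`, hence `O` (`#tors = 2`); so `σP = −P`, `P = τ(R)` for
`R ∈ M₀^{(d_K)}(ℚ)` killed by `n`, hence `R = O`. [cite: SilvermanAEC2009, X.2 Prop. 2.4 and Exercise 10.16] -/
theorem eq_zero_of_odd_nsmul_eq_zero_M0_one (hK : IsImaginaryQuadratic K)
    (P : (((⟨0, 21, 0, 112, 0⟩ : WeierstrassCurve ℚ).quadraticTwist 1).baseChange K).toAffine.Point)
    {n : ℕ} (hn : Odd n) (hP : n • P = 0) : P = 0 := by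
  obtain ⟨δ, hδ, hδK, -⟩ := exists_sq_eq_discr_and_span hK
  have hθ : δ ∉ Set.range (algebraMap ℚ K) := by rintro ⟨a, ha⟩; exact hδK a ha
  have hσσ : ∀ z, Literature.NumberTheory.QuadraticFields.Quadratic.conj hK.1 hθ hδ
      (Literature.NumberTheory.QuadraticFields.Quadratic.conj hK.1 hθ hδ z) = z :=
    Literature.NumberTheory.QuadraticFields.Quadratic.conj_conj hK.1 hθ hδ
  -- the `σ`-fixed part comes from `V(ℚ)` and is killed by `n`
  obtain ⟨Q, hQ⟩ : ∃ Q : ((⟨0, 21, 0, 112, 0⟩ : WeierstrassCurve ℚ).quadraticTwist 1).toAffine.Point,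
      incl K ((⟨0, 21, 0, 112, 0⟩ : WeierstrassCurve ℚ).quadraticTwist 1) Q =
        P + conjMap ((⟨0, 21, 0, 112, 0⟩ : WeierstrassCurve ℚ).quadraticTwist 1)
          (Literature.NumberTheory.QuadraticFields.Quadratic.conj hK.1 hθ hδ) P :=
    exists_incl_eq_of_conjMap_eq _ hK.1 hθ hδ (by rw [map_add, conjMap_conjMap _ hσσ, add_comm])
  have hQn : n • Q = 0 := by
    apply incl_injective (K := K) ((⟨0, 21, 0, 112, 0⟩ : WeierstrassCurve ℚ).quadraticTwist 1)
    rw [map_nsmul, hQ, map_zero, smul_add, ← map_nsmul, hP, map_zero, add_zero]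
  have hQ0 : Q = 0 :=
    eq_zero_of_odd_nsmul_eq_zero_of_torsionOrder_eq_two torsionOrder_M0_quadraticTwist_one hn hQn
  have hanti : conjMap ((⟨0, 21, 0, 112, 0⟩ : WeierstrassCurve ℚ).quadraticTwist 1)
      (Literature.NumberTheory.QuadraticFields.Quadratic.conj hK.1 hθ hδ) P = -P := by
    have h : P + conjMap ((⟨0, 21, 0, 112, 0⟩ : WeierstrassCurve ℚ).quadraticTwist 1)
        (Literature.NumberTheory.QuadraticFields.Quadratic.conj hK.1 hθ hδ) P = 0 := by
      rw [← hQ, hQ0, map_zero]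
    exact (neg_eq_of_add_eq_zero_right h).symm
  -- the `σ`-anti-fixed point comes from the twist by `d_K`
  obtain ⟨R, hR⟩ : ∃ R : ((⟨0, 21, 0, 112, 0⟩ : WeierstrassCurve ℚ).quadraticTwist
      (NumberField.discr K : ℚ)).toAffine.Point, twistMap (⟨0, 21, 0, 112, 0⟩ : WeierstrassCurve ℚ) hθ hδ R = P :=
    exists_twistMap_eq_of_conjMap_eq_neg _ hK.1 hθ hδ hanti
  have hd : (NumberField.discr K : ℚ) ≠ 0 := by exact_mod_cast NumberField.discr_ne_zero K
  have hRn : n • R = 0 := by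
    apply twistMap_injective (⟨0, 21, 0, 112, 0⟩ : WeierstrassCurve ℚ) hθ hδ
    rw [map_nsmul, hR, hP, map_zero]
  have hR0 : R = 0 :=
    eq_zero_of_odd_nsmul_eq_zero_of_torsionOrder_eq_two (torsionOrder_M0_quadraticTwist hd) hn hRn
  rw [← hR, hR0, map_zero]

/-- `M₀^{(1)} ⊗ K = ⟨0, 21, 0, 112, 0⟩` as a curve over `K`. [folklore] -/
theorem M0_quadraticTwist_one_baseChange :
    ((⟨0, 21, 0, 112, 0⟩ : WeierstrassCurve ℚ).quadraticTwist 1).baseChange K = (⟨0, 21, 0, 112, 0⟩ : WeierstrassCurve K) := by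
  rw [M0_quadraticTwist_one]
  ext <;> simp [baseChange]

/-- **A point of `M₀(K) = ⟨0,21,0,112,0⟩(K)` killed by an odd integer is `O`.**
[cite: SilvermanAEC2009, X.2 Prop. 2.4 and Exercise 10.16] -/
theorem eq_zero_of_odd_nsmul_eq_zero_M0 (hK : IsImaginaryQuadratic K)
    (P : (⟨0, 21, 0, 112, 0⟩ : WeierstrassCurve K).toAffine.Point) {n : ℕ} (hn : Odd n) (hP : n • P = 0) :
    P = 0 := by
  set e := Affine.Point.congrEquiv (M0_quadraticTwist_one_baseChange (K := K)) with he
  have h := eq_zero_of_odd_nsmul_eq_zero_M0_one hK (e.symm P) hn (by rw [← map_nsmul, hP, map_zero])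
  simpa using congrArg e h

/-! ## §4 `M₀(K)_tors = {O, T}` and `#X₀(49)(K)_tors = 2` -/

/-- `M₀ = ⟨0, 21, 0, 112, 0⟩` is elliptic over `K`. [folklore] -/
theorem isElliptic_M0_K : (⟨0, 21, 0, 112, 0⟩ : WeierstrassCurve K).IsElliptic := by
  rw [← cm7NFChange_smul (F := K)]; infer_instance

/-- **`M₀(K)_tors = {O, T}`**: a torsion point `t` has an odd multiple in `{O, T}` (`−7 = a² − 4b` and
`7 ~ b = 112` are not squares in `K`, the tree's `exists_odd_nsmul_mem_pair`), so `2 • t` is killed by an odd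
integer, hence `O` (§3), and `t ∈ M₀(K)[2] = {O, T}`. [cite: SilvermanTate2015, §3.5] [cite: SilvermanAEC2009, Exercise 10.16] -/
theorem isOfFinAddOrder_iff_M0_K (hK : IsImaginaryQuadratic K) {q : ℕ} (hq : q.Prime)
    (hq7 : jacobiSym q 7 = -1) (hdK : NumberField.discr K = -(4 * (q : ℤ)))
    (t : (⟨0, 21, 0, 112, 0⟩ : WeierstrassCurve K).toAffine.Point) :
    IsOfFinAddOrder t ↔ t = 0 ∨ t = (haveI := isElliptic_M0_K (K := K);
      (⟨0, 21, 0, 112, 0⟩ : WeierstrassCurve K).twoTorsionPoint) := by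
  haveI := isElliptic_M0_K (K := K)
  obtain ⟨h7, h7', -, -⟩ := not_isSquare_inertField hK hq hq7 hdK
  have hD : ¬ IsSquare ((⟨0, 21, 0, 112, 0⟩ : WeierstrassCurve K).a₂ ^ 2 -
      4 * (⟨0, 21, 0, 112, 0⟩ : WeierstrassCurve K).a₄) := by
    rw [show ((⟨0, 21, 0, 112, 0⟩ : WeierstrassCurve K).a₂ ^ 2 -
      4 * (⟨0, 21, 0, 112, 0⟩ : WeierstrassCurve K).a₄) = -7 by norm_num]
    exact h7
  have hb : ¬ IsSquare (⟨0, 21, 0, 112, 0⟩ : WeierstrassCurve K).a₄ := by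
    rw [show (⟨0, 21, 0, 112, 0⟩ : WeierstrassCurve K).a₄ = 112 by rfl]
    rintro ⟨r, hr⟩
    exact h7' (isSquare_of_sq_mul (k := 4) (by norm_num) (by linear_combination hr.symm))
  constructor
  · intro ht
    obtain ⟨m, hm, h⟩ := (⟨0, 21, 0, 112, 0⟩ : WeierstrassCurve K).exists_odd_nsmul_mem_pair hD hb ht
    have h2m : m • ((2 : ℕ) • t) = 0 := by
      rw [← mul_nsmul', mul_comm, mul_nsmul']
      rcases h with h | h
      · rw [h, nsmul_zero]
      · rw [h, two_nsmul, twoTorsionPoint_add_twoTorsionPoint]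
    have h2 : (2 : ℕ) • t = 0 := eq_zero_of_odd_nsmul_eq_zero_M0 hK _ hm h2m
    exact (⟨0, 21, 0, 112, 0⟩ : WeierstrassCurve K).eq_zero_or_eq_twoTorsionPoint_of_two_nsmul_eq_zero hD t h2
  · rintro (rfl | rfl)
    · exact IsOfFinAddOrder.zero
    · exact isOfFinAddOrder_iff_nsmul_eq_zero.mpr ⟨2, two_pos, by rw [two_nsmul, twoTorsionPoint_add_twoTorsionPoint]⟩

/-- **`#M₀(K)_tors = 2`.** [cite: SilvermanTate2015, §3.5] -/
theorem torsionOrder_M0_K (hK : IsImaginaryQuadratic K) {q : ℕ} (hq : q.Prime)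
    (hq7 : jacobiSym q 7 = -1) (hdK : NumberField.discr K = -(4 * (q : ℤ))) :
    (⟨0, 21, 0, 112, 0⟩ : WeierstrassCurve K).torsionOrder = 2 := by
  haveI := isElliptic_M0_K (K := K)
  unfold WeierstrassCurve.torsionOrder
  set T := (⟨0, 21, 0, 112, 0⟩ : WeierstrassCurve K).twoTorsionPoint with hT
  have hTtors : T ∈ AddCommGroup.torsion (⟨0, 21, 0, 112, 0⟩ : WeierstrassCurve K).toAffine.Point :=
    (AddCommGroup.mem_torsion _).mpr ((isOfFinAddOrder_iff_M0_K hK hq hq7 hdK T).mpr (Or.inr rfl))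
  have hT0 : T ≠ 0 := twoTorsionPoint_ne_zero _
  rw [Nat.card_eq_two_iff' (⟨T, hTtors⟩ : AddCommGroup.torsion (⟨0, 21, 0, 112, 0⟩ : WeierstrassCurve K).toAffine.Point)]
  refine ⟨0, fun h0 => hT0 (congrArg Subtype.val h0).symm, fun y hy => ?_⟩
  have hyfin : IsOfFinAddOrder (y : (⟨0, 21, 0, 112, 0⟩ : WeierstrassCurve K).toAffine.Point) := y.2
  rcases (isOfFinAddOrder_iff_M0_K hK hq hq7 hdK _).mp hyfin with h | h
  · exact Subtype.ext h
  · exact absurd (Subtype.ext h) hy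

/-- **`#X₀(49)(K)_tors = 2` for every imaginary quadratic `K` with `d_K = −4q`, `q` prime, `(q/7) = −1`**
(factor `t_K` of `𝔮₄₉`; transport of `torsionOrder_M0_K` along `cm7NFChange K • (cm7 ⊗ K) = M₀`,
`torsionOrder_variableChange_holds`). [cite: SilvermanTate2015, §3.5] [cite: SilvermanAEC2009, Exercise 10.16]
[cite: BurungaleCastellaSkinnerTian2022, Rem. D (p. 327)] -/
theorem torsionOrder_cm7_baseChange_eq_two (hK : IsImaginaryQuadratic K) {q : ℕ} (hq : q.Prime)
    (hq7 : jacobiSym q 7 = -1) (hdK : NumberField.discr K = -(4 * (q : ℤ))) :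
    (cm7.baseChange K).torsionOrder = 2 := by
  have h := torsionOrder_variableChange_holds (cm7.baseChange K) (cm7NFChange K)
  unfold torsionOrder_variableChange at h
  rw [cm7NFChange_smul] at h
  rw [← h]
  exact torsionOrder_M0_K hK hq hq7 hdK

end OverK

end Summit.BirchSwinnertonDyer.BirchSwinnertonDyer.Theorems.GoldfeldGoodTwists

end
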